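import Literature.AnabelianGeometry.SemiGraphs.TemperedOrigin
import Mathlib.CategoryTheory.Equivalence

/-!
# Tempered anabelian geometry, II: morphisms and localizations ([SemiAnbd] §6: Thm. 6.4, Def. 6.7 – Rmk. 6.9.1)

Mochizuki, *Semi-graphs of anabelioids*, Publ. RIMS **42** (2006) [SemiAnbd], §6, author's
manuscript pp. 70–77: Theorem 6.4 (Tempered Anabelian Theorem for Hyperbolic Curves over Local
Fields), the category of dominant localizations `DLoc_{G_K}(Π^temp_{X_K})` (pp. 73–74),
Definition 6.7 (tempered `DLoc`-type), Theorem 6.8 (Tempered Group-theoreticity of the Category of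
Dominant Localizations) (i)–(iv), Remark 6.8.1, Corollary 6.9 (Tempered Absoluteness of
Decomposition Groups for Genus Zero); Remark 6.9.1 is discussed below (not typed).
[cite: MochizukiSemiAnbd2006, §6 pp.70-77]

## Level of the typing

Over the interface `TemperedCurve p` of `TemperedAnabelian.lean`.  The further deep inputs of this
part of §6 — dominant morphisms of hyperbolic curves and the tempered-`π₁` functor on them
(Thm. 6.4), the scheme-theoretic category `DLoc_K(X_K)` of [Mzk8] §2 (hyperbolic partial
compactifications of finite étale coverings, dominant `K`-morphisms) with the tempered fundamental
groups of its objects (Def. 6.7, Thm. 6.8 (i)(ii)), and the arithmetic adjectives of Thm. 6.8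
(iii)(iv) / Cor. 6.9 (once-punctured elliptic curve, torsion closed point, isogenous to genus zero,
algebraic closed point, defined over a number field) — are recorded as INTERFACE data
(`TemperedCurveHom`, `DLocContext`, `CurveArithmeticFlags`) whose fields quote print; the printed
results are typed (a) as PREDICATES on these data (one `def … : Prop` per sub-item) and (b) as the
printed universally quantified statements `…Holds Ω` over the ORIGIN hypothesis structure
`TemperedMorphismOrigin p` (extending `TemperedOrigin p` by certificates for the data of this file;
threaded, never constructed; cell gate lesson G1); nothing is asserted.
-- TODO-merge: abc-iut-L3-t2 (tempered `π₁` functor), abc-iut-L4-t1 (curves, `DLoc_K`, decomposition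
groups), [Mzk8] = Mochizuki, *Galois sections in absolute anabelian geometry*, Nagoya Math. J. 179.

Renderings to note: "embedding of fields `L ↪ K`" (Thm. 6.4) is an element `g ∈ G_{ℚ_p}` with
`g(L) ⊆ K`, the induced `G_K → G_L` being `h ↦ g⁻¹ h g`; "outer homomorphism" = homomorphism up to
an inner automorphism of the target; the group-theoretic category `DLoc_{G_K}(Π^temp_{X_K})`
(pp. 73–74) is typed through its OBJECTS (`DLocObj`: `H ↠ J`, `H` open of finite index, `J` the
quotient by the closed normal subgroup generated by a collection of cuspidal geometric decomposition
groups, `J` hyperbolic) while the equivalence statements Thm. 6.8 (i), (ii) are typed over abstract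
categories supplied by `DLocContext` -- TODO(general form): morphisms of `DLoc_{G_K}(Π^temp)` as
outer DOF-type homomorphisms `J₁ → J₂` over `G_K`, and the functoriality "up to unique isomorphisms
of equivalences" in Thm. 6.8 (ii).  Thm. 6.8 (iii)'s compatibility with Tate modules is not typed
-- TODO(general form).  Deliberately NOT typed: Remark 6.8.1 ("the proofs of Theorem 6.8, (iii),
(iv), only require the isomorphism version of Theorem 6.4" — about proofs); Remark 6.9.1 (p. 77:
Cor. 6.9 "may be regarded as a weak form of the 'section conjecture' for `Π^temp_{X_K} ↠ G_K`";
"perhaps it is more natural to consider the section conjecture for the tempered fundamental group"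
— an OPEN PROBLEM / suggestion of the author, which by cell policy is not a Literature fact: if a
route ever needs the tempered section conjecture it is filed Summits-side as a `@[conjecture]`
obligation `∀ s : G_K →ₜ* Π^temp_{X_K} section of aug, ∃ x γ, range s ≤ γ D_x γ⁻¹`); Corollaries 6.10, 6.11,
Theorem 6.12, Remark 6.12.1 (they need the cuspidal torsor / Kummer structures of [Mzk8] §4:
companion file `TemperedAbsoluteness.lean`).  No statement is strengthened; nothing here takes a side
on [IUTchIII] Cor. 3.12.
-/

noncomputable section

namespace Literature.AnabelianGeometry.SemiGraphs

open scoped Pointwise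
open CategoryTheory

universe u

section Setting

variable (p : ℕ) [Fact p.Prime]

/-! ### Theorem 6.4 (Tempered Anabelian Theorem for Hyperbolic Curves over Local Fields) -/

/-- The datum of Theorem 6.4 for a pair `X_K`, `Y_L` (pp. 70–71): the SET of dominant morphisms of
schemes `X_K → Y_L` and, for each, the induced homomorphism of tempered fundamental groups (a
representative of the outer homomorphism given by "the tempered fundamental group functor").
INTERFACE BOUNDARY: schemes / dominant morphisms of hyperbolic curves and the functoriality of
`π₁^temp` are not in the tree -- TODO-merge: abc-iut-L3-t2, abc-iut-L4-t1.
[cite: MochizukiSemiAnbd2006, Thm 6.4 pp.70-71] -/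
structure TemperedCurveHom (X Y : TemperedCurve p) : Type 1 where
  /-- the set of dominant morphisms of schemes `X_K → Y_L` -/
  DomHom : Type
  /-- the homomorphism `Π^temp_{X_K} → Π^temp_{Y_L}` induced by a dominant morphism (a representative
  of the induced outer homomorphism) -/
  pi1 : DomHom → (X.PiTemp →ₜ* Y.PiTemp)

variable {p}

/-- The condition on a continuous homomorphism `φ : Π^temp_{X_K} → Π^temp_{Y_L}` in Theorem 6.4
(pp. 70–71): `φ` is of DOF-type and "fit[s] into a commutative diagram" over a morphism `G_K → G_L`
which "is an open immersion [i.e., an isomorphism onto an open subgroup of `G_L`] which arises from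
an embedding of fields `L ↪ K`" — inside `K̄`: some `g ∈ G_{ℚ_p}` with `g(L) ⊆ K`, the map
`G_K → G_L` being `h ↦ g⁻¹ h g`. [cite: MochizukiSemiAnbd2006, Thm 6.4 pp.70-71] -/
def IsGaloisCompatibleDOFHom (X Y : TemperedCurve p) (φ : X.PiTemp →ₜ* Y.PiTemp) : Prop :=
  IsDOFTypeHom φ ∧ ∃ g : GQp p,
    IntermediateField.map (g : AlgebraicClosure ℚ_[p] →ₐ[ℚ_[p]] AlgebraicClosure ℚ_[p]) Y.K ≤ X.K ∧
      ∀ x : X.PiTemp, Y.aug (φ x) = g⁻¹ * X.aug x * g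

/-- **[SemiAnbd] Theorem 6.4 (Tempered Anabelian Theorem for Hyperbolic Curves over Local
Fields)**, pp. 70–71: "The tempered fundamental group functor determines a bijection between the
set of dominant morphisms of schemes `X_K → Y_L` and the set of outer homomorphisms of DOF-type
`φ : Π^temp_{X_K} → Π^temp_{Y_L}` that fit into a commutative diagram [over] `G_K → G_L` for which
the induced morphism `G_K → G_L` is an open immersion which arises from an embedding of fields
`L ↪ K`."  Typed as: every `π₁(f)` satisfies the condition; every `φ` satisfying it is, up to an
inner automorphism of `Π^temp_{Y_L}`, some `π₁(f)`; and `π₁(f)`, `π₁(f')` define the same outer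
homomorphism only if `f = f'`. (Print: from [Mzk8] Thm. 1.2, i.e. [Mzk2] Thm. A.)
[cite: MochizukiSemiAnbd2006, Thm 6.4 pp.70-71] -/
def TemperedAnabelianTheorem {X Y : TemperedCurve p} (C : TemperedCurveHom p X Y) : Prop :=
  (∀ f : C.DomHom, IsGaloisCompatibleDOFHom X Y (C.pi1 f)) ∧
  (∀ φ : X.PiTemp →ₜ* Y.PiTemp, IsGaloisCompatibleDOFHom X Y φ →
    ∃ f : C.DomHom, ∃ y : Y.PiTemp, ∀ x : X.PiTemp, C.pi1 f x = y * φ x * y⁻¹) ∧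
  (∀ f f' : C.DomHom, (∃ y : Y.PiTemp, ∀ x : X.PiTemp, C.pi1 f' x = y * C.pi1 f x * y⁻¹) → f = f')

/-! ### The category `DLoc_{G_K}(Π^temp_{X_K})` (pp. 73–74): objects -/

/-- An object of `DLoc_{G_K}(Π^temp_{X_K})` (pp. 73–74): "a surjection of tempered groups `H ↠ J`
where `H ⊆ Π^temp_{X_K}` is an open subgroup of finite index; `J` is the quotient of `H` by the
closed normal subgroup generated by some collection of cuspidal geometric decomposition groups [of
`H`, i.e. subgroups `H ∩ I`, `I` a cuspidal geometric decomposition group of `Π^temp_{X_K}`]; and we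
assume that `J` is hyperbolic, in the sense that the image of `Δ^temp_X ∩ H` in `J` is nonabelian."
The object is recorded by `H` and the kernel `N` of `H ↠ J`.
[cite: MochizukiSemiAnbd2006, §6 pp.73-74] -/
structure DLocObj (X : TemperedCurve p) where
  /-- the open subgroup of finite index `H ⊆ Π^temp_{X_K}` -/
  H : Subgroup X.PiTemp
  isOpen_H : IsOpen (H : Set X.PiTemp)
  finiteIndex_H : H.FiniteIndex
  /-- the collection of cuspidal geometric decomposition groups of `H` generating the kernel -/
  gens : Set (Subgroup X.PiTemp)
  gens_cuspidal : ∀ I ∈ gens, ∃ I₀, X.IsCuspidalGeometricDecompositionGroup I₀ ∧ I = H ⊓ I₀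
  /-- the kernel `N` of `H ↠ J`: the closure of the normal closure in `H` of the generators -/
  N : Subgroup X.PiTemp
  N_eq : N = ((Subgroup.normalClosure
    (⋃ I ∈ gens, ((I.subgroupOf H : Subgroup H) : Set H))).topologicalClosure).map H.subtype
  /-- "`J` is hyperbolic": the image of `Δ^temp_X ∩ H` in `J = H/N` is nonabelian -/
  hyperbolic : ¬ ∀ a ∈ X.DeltaTemp ⊓ H, ∀ b ∈ X.DeltaTemp ⊓ H, a * b * a⁻¹ * b⁻¹ ∈ N

/-- The scheme-theoretic side of Theorem 6.8 as interface data for `X_K` (pp. 73–75; [Mzk8] §2):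
the category `DLoc_K(X_K)` of dominant localizations (objects: hyperbolic partial compactifications
`Z` of finite étale coverings of `X_K`, with `K`-structure; morphisms: dominant `K`-morphisms), the
object `X_K` itself, the tempered datum of each object and the homomorphism of tempered groups
induced by each morphism, a category structure on the group-theoretic objects `DLocObj X` (the
morphisms of `DLoc_{G_K}(Π^temp_{X_K})`, p. 74: outer homomorphisms `J₁ → J₂` of DOF-type
compatible with the outer homomorphisms to `G_K` — not constructed here), and "the tempered
fundamental group functor" between them.  INTERFACE BOUNDARY as in the module docstring
-- TODO-merge: abc-iut-L4-t1, abc-iut-L3-t2. [cite: MochizukiSemiAnbd2006, §6 pp.73-74] -/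
structure DLocContext (X : TemperedCurve p) : Type 2 where
  /-- the category `DLoc_K(X_K)` -/
  DLocK : Type 1
  [catK : Category.{0} DLocK]
  /-- the object `X_K` (trivial partial compactification of the trivial covering) -/
  self : DLocK
  /-- the tempered datum of the hyperbolic curve `Z` underlying an object -/
  curve : DLocK → TemperedCurve p
  /-- the homomorphism of tempered fundamental groups induced by a morphism `Z → Z'` (a
  representative of the outer homomorphism) -/
  pi1 : ∀ {Z Z' : DLocK}, (Z ⟶ Z') → ((curve Z).PiTemp →ₜ* (curve Z').PiTemp)
  /-- the identification `Π^temp` of the object `X_K` with `Π^temp_{X_K}` -/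
  selfIso : (curve self).PiTemp ≃ₜ* X.PiTemp
  /-- the category `DLoc_{G_K}(Π^temp_{X_K})`, with objects `DLocObj X` -/
  [catG : Category.{0} (DLocObj X)]
  /-- "the tempered fundamental group functor" `DLoc_K(X_K) → DLoc_{G_K}(Π^temp_{X_K})` -/
  pi1Functor : DLocK ⥤ DLocObj X

attribute [instance] DLocContext.catK

namespace TemperedCurve

/-- **[SemiAnbd] Definition 6.7**, p. 74: a closed point `x` (or `D_x`) "is of tempered `DLoc`-type
if `D_x` admits an open subgroup that arises as the image via a morphism `Z → X_K` of `DLoc_K(X_K)`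
of some cuspidal decomposition group of `Π^temp_Z`" (image taken up to the inner indeterminacy of
the induced outer homomorphism). [cite: MochizukiSemiAnbd2006, Def 6.7 p.74] -/
def IsTemperedDLocType (X : TemperedCurve p) (D : DLocContext X) (x : X.Pt) : Prop :=
  ∃ (Z : D.DLocK) (f : Z ⟶ D.self) (Dz : Subgroup (D.curve Z).PiTemp) (γ : ConjAct X.PiTemp),
    (D.curve Z).IsCuspidalDecompositionGroup Dz ∧
    let img : Subgroup X.PiTemp :=
      γ • (Dz.map (D.pi1 f).toMonoidHom).map D.selfIso.toMulEquiv.toMonoidHom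
    img ≤ X.decomp x ∧
      IsOpen ((img.subgroupOf (X.decomp x) : Subgroup (X.decomp x)) : Set (X.decomp x))

/-! ### Theorem 6.8 (Tempered Group-theoreticity of the Category of Dominant Localizations) -/

/-- **[SemiAnbd] Theorem 6.8 (i)**, p. 74: "The tempered fundamental group functor determines
equivalences of categories `DLoc_K(X_K) ≅ DLoc_{G_K}(Π^temp_{X_K})`" (stated for `X_K`; the same
for `Y_L`). [cite: MochizukiSemiAnbd2006, Thm 6.8(i) p.74] -/
def DLocEquivalence (X : TemperedCurve p) (D : DLocContext X) : Prop :=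
  letI := D.catG
  D.pi1Functor.IsEquivalence

/-- **[SemiAnbd] Theorem 6.8 (ii)**, p. 74, first part: "Every isomorphism of tempered groups
`α : Π^temp_{X_K} ≅ Π^temp_{Y_L}` induces an equivalence of categories
`DLoc_{G_K}(Π^temp_{X_K}) ≅ DLoc_{G_L}(Π^temp_{Y_L})`, hence also an equivalence
`DLoc_K(X_K) ≅ DLoc_L(Y_L)`, in a fashion that is functorial, up to unique isomorphisms of
equivalences of categories, with respect to `α`" — typed as: there is an equivalence of the
group-theoretic categories whose object map is transport of `(H, N)` along `α`.
-- TODO(general form): functoriality in `α` up to unique isomorphism of equivalences.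
[cite: MochizukiSemiAnbd2006, Thm 6.8(ii) p.74] -/
def IsoInducesDLocEquivalence (X Y : TemperedCurve p) (DX : DLocContext X) (DY : DLocContext Y)
    (α : X.PiTemp ≃ₜ* Y.PiTemp) : Prop :=
  letI := DX.catG
  letI := DY.catG
  ∃ E : DLocObj X ≌ DLocObj Y, ∀ A : DLocObj X,
    (E.functor.obj A).H = A.H.map α.toMulEquiv.toMonoidHom ∧
      (E.functor.obj A).N = A.N.map α.toMulEquiv.toMonoidHom

/-- **[SemiAnbd] Theorem 6.8 (ii)**, p. 74, last sentence: "Moreover, `α` preserves the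
decomposition groups of tempered `DLoc`-type." [cite: MochizukiSemiAnbd2006, Thm 6.8(ii) p.74] -/
def IsoPreservesTemperedDLocType (X Y : TemperedCurve p) (DX : DLocContext X) (DY : DLocContext Y)
    (α : X.PiTemp ≃ₜ* Y.PiTemp) : Prop :=
  ∀ x : X.Pt, X.IsTemperedDLocType DX x →
    ∃ y : Y.Pt, Y.IsTemperedDLocType DY y ∧
      ∃ γ : ConjAct Y.PiTemp, (X.decomp x).map α.toMulEquiv.toMonoidHom = γ • Y.decomp y

/-- The arithmetic adjectives of Theorem 6.8 (iii), (iv) and Corollary 6.9 for `X_K`, as interface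
flags (pp. 74–75): "once-punctured elliptic curve"; "torsion closed points — i.e., the closed points
that arise from torsion points of the underlying elliptic curve"; "isogenous [cf. §0] to a hyperbolic
curve of genus zero"; "algebraic closed points"; "defined over a number field".  INTERFACE BOUNDARY:
none of these is defined in the tree for the (absent) curve `X_K` -- TODO-merge: abc-iut-L4-t1.
[cite: MochizukiSemiAnbd2006, Thm 6.8(iii)-(iv) pp.74-75] -/
structure CurveArithmeticFlags (X : TemperedCurve p) where
  /-- `X_K` is a once-punctured elliptic curve -/
  IsOncePuncturedElliptic : Prop
  /-- the torsion closed points of `X̄_K` -/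
  IsTorsionPt : X.Pt → Prop
  /-- `X_K` is isogenous to a hyperbolic curve of genus zero -/
  IsIsogenousToGenusZero : Prop
  /-- the algebraic closed points of `X̄_K` -/
  IsAlgebraicPt : X.Pt → Prop
  /-- `X_K` is defined over a number field -/
  IsDefinedOverNumberField : Prop

/-- ORIGIN hypotheses for the interface data of this file (extending `TemperedOrigin p`; threaded
as a parameter, never constructed): "`C` IS the set of dominant morphisms `X_K → Y_L` with the
tempered-`π₁` functor" (Thm. 6.4), "`D` IS `DLoc_K(X_K)` with its tempered data and functor"
([Mzk8] §2; pp. 73–74), "`a` IS the tuple of arithmetic adjectives of `X_K`" (pp. 74–75).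
-- TODO-merge: abc-iut-L3-t2, abc-iut-L4-t1. [cite: MochizukiSemiAnbd2006, §6 pp.70-75] -/
structure _root_.Literature.AnabelianGeometry.SemiGraphs.TemperedMorphismOrigin (p : ℕ) [Fact p.Prime]
    extends TemperedOrigin p where
  /-- "`C` is the genuine datum of Theorem 6.4 for `X_K`, `Y_L`" -/
  IsDomHomOrigin : ∀ {X Y : TemperedCurve p}, TemperedCurveHom p X Y → Prop
  /-- "`D` is `DLoc_K(X_K)` with the tempered fundamental group functor" -/
  IsDLocOrigin : ∀ {X : TemperedCurve p}, DLocContext X → Prop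
  /-- "`a` records the printed arithmetic properties of `X_K`" -/
  IsFlagsOrigin : ∀ {X : TemperedCurve p}, CurveArithmeticFlags X → Prop

/-- `α` *preserves the decomposition groups* of the closed points in the classes `S ⊆ X̄_K`,
`T ⊆ Ȳ_L`: it carries the conjugates of the `D_x`, `x ∈ S`, exactly onto the conjugates of the
`D_y`, `y ∈ T` (the phrase of Thm. 6.8 (ii)–(iv), Cor. 6.9). [cite: MochizukiSemiAnbd2006, Thm 6.8 p.74] -/
def PreservesDecompOf (X Y : TemperedCurve p) (α : X.PiTemp ≃ₜ* Y.PiTemp) (S : Set X.Pt)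
    (T : Set Y.Pt) : Prop :=
  ∀ D : Subgroup X.PiTemp,
    (∃ x ∈ S, ∃ γ : ConjAct X.PiTemp, D = γ • X.decomp x) ↔
      ∃ y ∈ T, ∃ γ : ConjAct Y.PiTemp, D.map α.toMulEquiv.toMonoidHom = γ • Y.decomp y

/-- **[SemiAnbd] Theorem 6.8 (iii)**, p. 75: "suppose further that `X_K`, `Y_L` are once-punctured
elliptic curves. Then `α` preserves the decomposition groups of the torsion closed points".
-- TODO(general form): "the resulting bijection between torsion closed points of `X_K`, `Y_L` is
compatible with the isomorphism on abelianizations of geometric fundamental groups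
`Δ_X^ab ≅ Δ_Y^ab` — i.e., Tate modules — induced by `α`" is not typed.
[cite: MochizukiSemiAnbd2006, Thm 6.8(iii) p.75] -/
def IsoPreservesTorsionDecomp (X Y : TemperedCurve p) (aX : CurveArithmeticFlags X)
    (aY : CurveArithmeticFlags Y) (α : X.PiTemp ≃ₜ* Y.PiTemp) : Prop :=
  aX.IsOncePuncturedElliptic → aY.IsOncePuncturedElliptic →
    PreservesDecompOf X Y α {x | aX.IsTorsionPt x} {y | aY.IsTorsionPt y}

/-- **[SemiAnbd] Theorem 6.8 (iv)**, p. 75, first sentence: "suppose further that `X_K`, `Y_L` are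
isogenous to hyperbolic curves of genus zero. Then the isomorphism `α` preserves the decomposition
groups of the algebraic closed points." [cite: MochizukiSemiAnbd2006, Thm 6.8(iv) p.75] -/
def IsoPreservesAlgebraicDecomp (X Y : TemperedCurve p) (aX : CurveArithmeticFlags X)
    (aY : CurveArithmeticFlags Y) (α : X.PiTemp ≃ₜ* Y.PiTemp) : Prop :=
  aX.IsIsogenousToGenusZero → aY.IsIsogenousToGenusZero →
    PreservesDecompOf X Y α {x | aX.IsAlgebraicPt x} {y | aY.IsAlgebraicPt y}

/-- **[SemiAnbd] Theorem 6.8 (iv)**, p. 75, second sentence: "In particular, `X_K` is defined over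
a number field if and only if `Y_L` is" (in the situation of (iv): an isomorphism `α` exists and
both curves are isogenous to genus zero). [cite: MochizukiSemiAnbd2006, Thm 6.8(iv) p.75] -/
def DefinedOverNumberFieldIff (X Y : TemperedCurve p) (aX : CurveArithmeticFlags X)
    (aY : CurveArithmeticFlags Y) : Prop :=
  aX.IsIsogenousToGenusZero → aY.IsIsogenousToGenusZero → Nonempty (X.PiTemp ≃ₜ* Y.PiTemp) →
    (aX.IsDefinedOverNumberField ↔ aY.IsDefinedOverNumberField)

/-- **[SemiAnbd] Corollary 6.9 (Tempered Absoluteness of Decomposition Groups for Genus Zero)**,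
p. 75: "In the situation of Theorem 6.8, (iv), suppose further both `X_K` and `Y_L` are defined
over a number field. Then the isomorphism `α` preserves the decomposition groups of all the closed
points." [cite: MochizukiSemiAnbd2006, Cor 6.9 p.75] -/
def IsoPreservesAllDecompGenusZeroNF (X Y : TemperedCurve p) (aX : CurveArithmeticFlags X)
    (aY : CurveArithmeticFlags Y) (α : X.PiTemp ≃ₜ* Y.PiTemp) : Prop :=
  aX.IsIsogenousToGenusZero → aY.IsIsogenousToGenusZero →
    aX.IsDefinedOverNumberField → aY.IsDefinedOverNumberField →
    PreservesDecompOf X Y α Set.univ Set.univ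

end TemperedCurve

/-! ### The printed statements over the origin hypotheses -/

namespace TemperedMorphismOrigin

/-- **[SemiAnbd] Theorem 6.4** (pp. 70–71) as printed: for all hyperbolic curves `X_K`, `Y_L` over
finite extensions of `ℚ_p`, with the genuine datum of dominant morphisms and the tempered-`π₁`
functor (asserted only for certified data). [cite: MochizukiSemiAnbd2006, Thm 6.4 pp.70-71] -/
def TemperedAnabelianTheoremHolds (Ω : TemperedMorphismOrigin p) : Prop :=
  ∀ (X Y : TemperedCurve p) (C : TemperedCurveHom p X Y), Ω.IsHyperbolicCurveOrigin X →
    Ω.IsHyperbolicCurveOrigin Y → Ω.IsDomHomOrigin C → TemperedAnabelianTheorem C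

/-- **[SemiAnbd] Theorem 6.8 (i), (ii)** (p. 74) as printed: for all hyperbolic curves `X_K`, `Y_L`
over finite extensions of `ℚ_p` with their genuine `DLoc` data, and every isomorphism of tempered
groups `α` (asserted only for certified data). [cite: MochizukiSemiAnbd2006, Thm 6.8(i)-(ii) p.74] -/
def DLocGroupTheoreticityHolds (Ω : TemperedMorphismOrigin p) : Prop :=
  ∀ (X Y : TemperedCurve p) (DX : DLocContext X) (DY : DLocContext Y),
    Ω.IsHyperbolicCurveOrigin X → Ω.IsHyperbolicCurveOrigin Y → Ω.IsDLocOrigin DX →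
    Ω.IsDLocOrigin DY →
    X.DLocEquivalence DX ∧ ∀ α : X.PiTemp ≃ₜ* Y.PiTemp,
      X.IsoInducesDLocEquivalence Y DX DY α ∧ X.IsoPreservesTemperedDLocType Y DX DY α

/-- **[SemiAnbd] Theorem 6.8 (iii), (iv) and Corollary 6.9** (p. 75) as printed: for all hyperbolic
curves `X_K`, `Y_L` over finite extensions of `ℚ_p` with their genuine arithmetic adjectives, and
every isomorphism of tempered groups `α` (asserted only for certified data).
[cite: MochizukiSemiAnbd2006, Thm 6.8(iii)-(iv), Cor 6.9 p.75] -/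
def DecompositionPreservationHolds (Ω : TemperedMorphismOrigin p) : Prop :=
  ∀ (X Y : TemperedCurve p) (aX : TemperedCurve.CurveArithmeticFlags X)
    (aY : TemperedCurve.CurveArithmeticFlags Y),
    Ω.IsHyperbolicCurveOrigin X → Ω.IsHyperbolicCurveOrigin Y → Ω.IsFlagsOrigin aX →
    Ω.IsFlagsOrigin aY →
    X.DefinedOverNumberFieldIff Y aX aY ∧ ∀ α : X.PiTemp ≃ₜ* Y.PiTemp,
      X.IsoPreservesTorsionDecomp Y aX aY α ∧ X.IsoPreservesAlgebraicDecomp Y aX aY α ∧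
        X.IsoPreservesAllDecompGenusZeroNF Y aX aY α

end TemperedMorphismOrigin

end Setting

end Literature.AnabelianGeometry.SemiGraphs

end
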